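import Summits.ResolutionOfSingularities.ResolutionOfSingularities.Theorems.FrobeniusLadderFInjectiveMacaulayficationFrobeniusPowerOfFedderAt
import HarnessLib

/-!
# (C3a) registered stub `stub_frobeniusPower_of_fedderAt` (crux `FInjectiveMacaulayfication`, skeleton v16 §18 CN engine)

Closes the REGISTERED stub (C3a) `stub_frobeniusPower_of_fedderAt` of crux stmt-ResolutionOfSingularities-15315, skeleton v16
`50b56ac7` §18 (reshaped by the lead: `[CharP k p]` added — without it false, witness `k = ℚ, p = 2, P = (X,Y), g = 2XY`), BY NAME,
from res-L1-w45a-stub-3's landed `FrobeniusPowerOfFedderAt.frobeniusPower_of_fedderAt` (same statement, same correction).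
[OURS · L1 W4.5a] No definitions, no named facts. [folklore]
-/

set_option linter.dupNamespace false

namespace Summit.ResolutionOfSingularities.ResolutionOfSingularities.Theorems.FInjectiveMacaulayfication.CNFrobeniusPowerStub

/-- (C3a) the residue-point dictionary, trivial direction — registered stub name; proof = stub-3's theorem. [folklore] -/
theorem stub_frobeniusPower_of_fedderAt : ∀ (p : ℕ) [Fact p.Prime] (k : Type) [Field k] [CharP k p] (n : ℕ)
    (g : MvPolynomial (Fin n) k) (P : Ideal (MvPolynomial (Fin n) k)) [P.IsMaximal],
    (MvPolynomial.map (algebraMap k (MvPolynomial (Fin n) k ⧸ P)) g) ^ (p - 1) ∉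
      Ideal.span (Set.range fun i : Fin n =>
        (MvPolynomial.X i - MvPolynomial.C (Ideal.Quotient.mk P (MvPolynomial.X i))) ^ p) →
    g ^ (p - 1) ∉ Literature.RingTheory.TightClosure.frobeniusPower p P :=
  Summit.ResolutionOfSingularities.ResolutionOfSingularities.Theorems.FInjectiveMacaulayfication.FrobeniusPowerOfFedderAt.frobeniusPower_of_fedderAt

end Summit.ResolutionOfSingularities.ResolutionOfSingularities.Theorems.FInjectiveMacaulayfication.CNFrobeniusPowerStub
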